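import Summits.Ventures.PercRepro.PointedMinFace

/-!
# PercRepro — CSₓ-MIN-FACE: the MAX form of the pointed MIN-FACE (typer-2, gen 5)

The lead (09:32:00Z, corrected 09:33:04Z): the statement of record for the inductive closure of the x-pointed
Lemma B⁺ is the MAX form — `CSₓ(c) := CS_B(c) − 2·max_x n_x(c)`, i.e. `CSₓ = min_x Φₓ` (`cubeSumX`), satisfies
MIN-FACE: `CSₓ(c) ≥ min(CSₓ(c|x_k=0), CSₓ(c|x_k=1))`. It is WEAKER than the per-x form `PointedMinFace`
(`maxPointedMinFace_of_pointedMinFace`: take the minimum over `x` on both sides) and still closes the chain: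
`CSₓ ≥ 0` by induction on the dimension ⇒ `Φₓ ≥ 0` for every `x` ⇒ B⁺ₓ ⇒ Lemma B ⇒ C-005.

* **`cubeSumX c`** — `min_x Φₓ(c)` (`Finset.inf'` over the three crossing cells); `cubeSumX_le_pointedSum`;
  **`cubeSumX_eq_sub_sup`**: `CSₓ(c) = CS_B(c) − 2·sup_x nPairCount x c` (the lead's definition);
  `cubeSumX_nonneg_iff`: `CSₓ ≥ 0 ⟺ ∀ x, Φₓ ≥ 0`;
* **`crossSumX c₀ c₁`** — `min_x 2·X_{Kₓ}(c₀, c₁)`, the bilinear partner (`cubeSumX_eq_crossSumX_facets`: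
  `CSₓ(c) = crossSumX(c|x_k=0, c|x_k=1)`);
* **`MaxPointedMinFace`** — CSₓ-MIN-FACE in the stamp-65 bilinear shape for two single-merge maps `c₀ ≤ c₁`:
  `min(CSₓ(c₀), CSₓ(c₁)) ≤ crossSumX(c₀, c₁)`; the facet form `MaxPointedMinFaceFacet`;
  **`maxPointedMinFace_of_pointedMinFace`** (the per-x form implies it);
* **`cubeSumX_nonneg_of_maxPointedMinFace`** — `CSₓ ≥ 0` for every single-merge map (induction on the dimension;
  base `d = 0`: every `Φₓ = 0`), **`xPointedBPlus_of_maxPointedMinFace`**, **`C005_of_maxPointedMinFace`**.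

STATUS OF RECORD (p4 09:41:57Z / 09:43:23Z, kissat; witnesses recounted): **`MaxPointedMinFace` is FALSE** — for
single-merge maps the MAX form is UNSAT at `d = 5, 6` (j158347, j158352) and SAT at `d = 7` (j158359: `g = 5`,
`b = 0`, `n₁ = 4`, `CSₓ(c) = 1` while both facets have `CSₓ = 2` — no crossing pair at all, the n-pairs alone
break it; p4's first witness j158355, `g = 7, b = 2, n₁ = 5`, `CSₓ(c) = 0 < 1`, breaks both forms). For ALL
monotone maps the MAX form fails already at `d = 5` (lead 09:33:04Z). So neither pointed MIN-FACE form closes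
B⁺ₓ inductively from `d = 7` on; `XPointedBPlus` itself survives (UNSAT single-merge `d ≤ 7`, j158009). The
Props are kept as the exact record; the implications to C-005 are true but their hypotheses are false.
-/

namespace PercRepro

open Finset

section CubeSumX

variable {S : Type*} [Fintype S] [DecidableEq S]

/-- **`CSₓ(c) = min_x Φₓ(c)`** — the Lemma-B class sum minus twice the largest pointed n-pair count. -/
noncomputable def cubeSumX (c : Config S → Setoid (Fin 4)) : ℝ :=
  univ.inf' univ_nonempty fun a : Fin 3 => pointedSum a c

/-- `CSₓ ≤ Φₓ` at every cell. -/
theorem cubeSumX_le_pointedSum (a : Fin 3) (c : Config S → Setoid (Fin 4)) :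
    cubeSumX c ≤ pointedSum a c :=
  Finset.inf'_le _ (mem_univ a)

/-- `CSₓ ≥ 0` iff `Φₓ ≥ 0` at every cell. -/
theorem cubeSumX_nonneg_iff (c : Config S → Setoid (Fin 4)) :
    0 ≤ cubeSumX c ↔ ∀ a : Fin 3, 0 ≤ pointedSum a c := by
  unfold cubeSumX
  rw [Finset.le_inf'_iff]
  exact ⟨fun h a => h a (mem_univ a), fun h a _ => h a⟩

/-- **`CSₓ(c) = CS_B(c) − 2·sup_x n_x(c)`** (the lead's definition, 09:32:00Z). -/
theorem cubeSumX_eq_sub_sup (c : Config S → Setoid (Fin 4)) :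
    cubeSumX c = cubeSumB c - 2 * ((univ.sup fun a : Fin 3 => nPairCount cross4 c a : ℕ) : ℝ) := by
  obtain ⟨a₀, -, ha₀⟩ := Finset.exists_max_image univ (fun a : Fin 3 => nPairCount cross4 c a) univ_nonempty
  have hsup : (univ.sup fun a : Fin 3 => nPairCount cross4 c a) = nPairCount cross4 c a₀ :=
    le_antisymm (Finset.sup_le fun b _ => ha₀ b (mem_univ b)) (Finset.le_sup (mem_univ a₀))
  rw [hsup]
  refine le_antisymm ?_ ?_
  · refine le_trans (cubeSumX_le_pointedSum a₀ c) ?_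
    rw [cubeSumB_eq_pointedSum_add a₀ c]
    linarith
  · unfold cubeSumX
    refine Finset.le_inf' _ _ fun b _ => ?_
    rw [cubeSumB_eq_pointedSum_add b c]
    have : (nPairCount cross4 c b : ℝ) ≤ nPairCount cross4 c a₀ := by exact_mod_cast ha₀ b (mem_univ b)
    linarith

/-- **`crossSumX(c₀, c₁) = min_x 2·X_{Kₓ}(c₀, c₁)`** — the bilinear partner of `CSₓ`. -/
noncomputable def crossSumX (c₀ c₁ : Config S → Setoid (Fin 4)) : ℝ :=
  univ.inf' univ_nonempty fun a : Fin 3 => 2 * crossSum (pointedKernel a) c₀ c₁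

/-- `crossSumX ≤ 2·X_{Kₓ}` at every cell. -/
theorem crossSumX_le (a : Fin 3) (c₀ c₁ : Config S → Setoid (Fin 4)) :
    crossSumX c₀ c₁ ≤ 2 * crossSum (pointedKernel a) c₀ c₁ :=
  Finset.inf'_le _ (mem_univ a)

/-- **`CSₓ(c) = crossSumX(c|x_k=0, c|x_k=1)`** at every coordinate. -/
theorem cubeSumX_eq_crossSumX_facets (c : Config S → Setoid (Fin 4)) (k : S) :
    cubeSumX c = crossSumX (facetBot c k) (facetTop c k) := by
  unfold cubeSumX crossSumX
  exact Finset.inf'_congr univ_nonempty rfl fun a _ => pointedSum_eq_two_mul_crossSum a c k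

end CubeSumX

/-! ### CSₓ-MIN-FACE and its consequences -/

/-- **CSₓ-MIN-FACE** (the lead's statement of record, 09:32:00Z / 09:33:04Z) in the bilinear shape: for two
single-merge maps `c₀ ≤ c₁` (pointwise) on one cube, `min(CSₓ(c₀), CSₓ(c₁)) ≤ crossSumX(c₀, c₁)`. Exhaustive
at single-merge `d = 5` (485,635,175 coordinate tests, 0 violations), UNSAT `d = 6`; **FALSE at `d = 7`**
(p4 j158359 / j158355, 09:43:23Z). Kept as the record. -/
def MaxPointedMinFace : Prop :=
  ∀ {S : Type} [Fintype S] [DecidableEq S] (c₀ c₁ : Config S → Setoid (Fin 4)),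
    SingleMergeMap c₀ → SingleMergeMap c₁ → (∀ ρ, c₀ ρ ≤ c₁ ρ) →
      min (cubeSumX c₀) (cubeSumX c₁) ≤ crossSumX c₀ c₁

/-- **CSₓ-MIN-FACE, facet form**: `CSₓ(c) ≥ min(CSₓ(c|x_k=0), CSₓ(c|x_k=1))` for every single-merge map and
coordinate. FALSE at `d = 7` (p4 j158359). -/
def MaxPointedMinFaceFacet : Prop :=
  ∀ {S : Type} [Fintype S] [DecidableEq S] (c : Config S → Setoid (Fin 4)), SingleMergeMap c →
    ∀ k : S, min (cubeSumX (facetBot c k)) (cubeSumX (facetTop c k)) ≤ cubeSumX c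

/-- **The per-x form implies the MAX form** (minimum over `x` on both sides). -/
theorem maxPointedMinFace_of_pointedMinFace (h : PointedMinFace) : MaxPointedMinFace := by
  intro S _ _ c₀ c₁ h₀ h₁ hle
  unfold crossSumX
  refine Finset.le_inf' _ _ fun a _ => ?_
  exact le_trans (min_le_min (cubeSumX_le_pointedSum a c₀) (cubeSumX_le_pointedSum a c₁))
    (h a c₀ c₁ h₀ h₁ hle)

/-- The bilinear MAX form implies its facet form. -/
theorem maxPointedMinFaceFacet_of_maxPointedMinFace (h : MaxPointedMinFace) : MaxPointedMinFaceFacet := by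
  intro S _ _ c hc k
  rw [cubeSumX_eq_crossSumX_facets c k]
  exact h (facetBot c k) (facetTop c k) (facetBot_singleMergeMap hc k) (facetTop_singleMergeMap hc k)
    (facetBot_le_facetTop hc k)

/-- **CSₓ-MIN-FACE gives `CSₓ ≥ 0` for every single-merge map** — induction on the dimension alone (the 0-cube
has every `Φₓ = 0`; both facets are single-merge maps of one dimension less). -/
theorem cubeSumX_nonneg_of_maxPointedMinFaceFacet (h : MaxPointedMinFaceFacet) :
    ∀ {S : Type} [Fintype S] [DecidableEq S] (c : Config S → Setoid (Fin 4)), SingleMergeMap c →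
      0 ≤ cubeSumX c := by
  intro S _ _ c hc
  suffices key : ∀ n : ℕ, ∀ (S : Type) [Fintype S] [DecidableEq S], Fintype.card S = n →
      ∀ c : Config S → Setoid (Fin 4), SingleMergeMap c → 0 ≤ cubeSumX c from key _ S rfl c hc
  intro n
  induction n with
  | zero =>
    intro S _ _ hS c _
    have hempty : IsEmpty S := Fintype.card_eq_zero_iff.mp hS
    rw [cubeSumX_nonneg_iff]
    intro a
    unfold pointedSum cubeSum
    refine Finset.sum_nonneg fun ρ _ => ?_
    have hρ : ρᶜ = ρ := funext fun s => hempty.elim s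
    rw [hρ, pointedKernel_self]
  | succ n ih =>
    intro S _ _ hS c hc
    obtain ⟨k⟩ : Nonempty S := Fintype.card_pos_iff.mp (by omega)
    have hcard : Fintype.card {s // s ≠ k} = n := by
      have := Fintype.card_subtype_compl (fun s : S => s = k)
      rw [Fintype.card_subtype_eq, hS] at this
      simpa using this
    refine le_trans (le_min ?_ ?_) (h c hc k)
    · exact ih _ hcard (facetBot c k) (facetBot_singleMergeMap hc k)
    · exact ih _ hcard (facetTop c k) (facetTop_singleMergeMap hc k)

/-- **CSₓ-MIN-FACE (bilinear) gives `CSₓ ≥ 0` for every single-merge map.** -/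
theorem cubeSumX_nonneg_of_maxPointedMinFace (h : MaxPointedMinFace) :
    ∀ {S : Type} [Fintype S] [DecidableEq S] (c : Config S → Setoid (Fin 4)), SingleMergeMap c →
      0 ≤ cubeSumX c :=
  cubeSumX_nonneg_of_maxPointedMinFaceFacet (maxPointedMinFaceFacet_of_maxPointedMinFace h)

/-- **CSₓ-MIN-FACE gives the x-pointed Lemma B⁺** (`Φₓ ≥ CSₓ ≥ 0` at every cell). -/
theorem xPointedBPlus_of_maxPointedMinFace (h : MaxPointedMinFace) : XPointedBPlus :=
  fun c hc a => (pointedSum_nonneg_iff a c).1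
    (le_trans (cubeSumX_nonneg_of_maxPointedMinFace h c hc) (cubeSumX_le_pointedSum a c))

/-- **CSₓ-MIN-FACE gives Lemma B for single-merge maps.** -/
theorem lemmaB_singleMerge_of_maxPointedMinFace (h : MaxPointedMinFace) :
    ∀ {S : Type} [Fintype S] [DecidableEq S] (c : Config S → Setoid (Fin 4)), SingleMergeMap c →
      0 ≤ cubeSumB c :=
  lemmaB_of_xPointed (xPointedBPlus_of_maxPointedMinFace h)

/-- **CSₓ-MIN-FACE closes C-005.** -/
theorem C005_of_maxPointedMinFace (h : MaxPointedMinFace) : C005 :=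
  C005_of_xPointedBPlus (xPointedBPlus_of_maxPointedMinFace h)

end PercRepro
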